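import Summits.BirchSwinnertonDyer.BirchSwinnertonDyer.Theorems.GenusKolyvaginAtTwoPowDvdShaCardAtTwoRTBottomRungLocalInputs
import Summits.BirchSwinnertonDyer.BirchSwinnertonDyer.Theorems.GenusKolyvaginAtTwoPowDvdShaCardAtTwoRTBottomRungNewPrime
import Summits.BirchSwinnertonDyer.BirchSwinnertonDyer.Theorems.GenusKolyvaginAtTwoPowDvdShaCardAtTwoPosTTranspositionFrame
import Summits.BirchSwinnertonDyer.BirchSwinnertonDyer.Theorems.ByReductionTypeAtTwoRankOneAtTwoOffBigImageOddLocalEngineRegularKolyvaginPrimeDictionary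
import Summits.BirchSwinnertonDyer.BirchSwinnertonDyer.Theorems.ByReductionTypeAtTwoRankOneAtTwoOffBigImageOddLocalEngineRegularLocalStructure
import HarnessLib

/-!
# Route `GenusKolyvaginAtTwo`, crux L⁺_T `PowDvdShaCardAtTwoPosT` (stmt-BirchSwinnertonDyer-23379), road «E4⁺», socket hbot⁺ (LEAD R10″) —
# LAYER 1 OF THE BOTTOM RUNG AT TRANSPOSITION-DEEP PRIMES: the `ℓ′`-inputs (`hmeet`/`hz`, `hXs`, (hgen), `hl'`) with `Δ < 0` and Gross's
# (3.2) replaced by «some Frobenius above `ℓ` is an involution of `E[q]` moving a point of `E[2]`»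

Seat `bsd-line-gk2-p4` g24 (WIDTH-5 attach, cell `bsd-f1-sign2`), `--supports stmt-BirchSwinnertonDyer-23379 --as helper`.
THEOREMS ONLY (no definition, no named fact, no `sorry`).  BSD is NOT proved by any of this; L⁺_T / Q4_T are NOT claimed; nothing is closed.

WHY.  LEAD gk2-p1 g16/g17's bottom-rung engine (`…RTBottomRungEngine.false_of_bottomRung_engine` and its Čebotarev/deep layers) feeds the socket
`hbot` of the KS assembly; its `Δ < 0` inputs at the new prime `ℓ′` and at the free primes are the two files `…RTBottomRungLocalInputs` §3
(`bottomRung_newPrime_inputs_of_K`, `localization_two_nsmul_eq_zero_of_K`: the LINE 6 dictionary `ℚ_ℓ ⟷ K_λ` at a Gross prime) and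
`…RTBottomRungNewPrime` §2–§3 (`forall_mem_kummerSelmerStructure_exists_eq_zsmul`, `invWeilPairing_localization_ne_zero_of_newPrime`: `#𝓛_ℓ = 2^M`).
On `Δ > 0` the road runs at TRANSPOSITION-deep primes (gk2-p2 g22 R9-L / LEAD R9-FINAL): the regular twins of both local leaves are ALREADY
in the tree for the sibling route `ByReductionTypeAtTwo` (ns `…OffBigImageOddLocalAtTwo.Engine`: `zsmul_mem_torsionLocalKer_iff_resTorsion_of_notMem_regular`,
`natCard_kummerLocalConditionAt_two_pow_eq_regular`, «no sign condition on `Δ`»).  THIS FILE re-assembles the four engine inputs over them: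
* §0 `regularFrob_level_of_transposition` / `regularFrob_two_of_transposition` — from gk2-p2's transposition clause
  `TRANSP ℓ := ∃ v 𝔓 h, ℓ ∈ v ∧ 𝔓 ∈ v.primesAbove ∧ IsArithFrobAt h 𝔓 ∧ ∃ u : geomTorsion W 2, h • u ≠ u` at a Zhang–Kolyvagin prime of index
  `≥ M` to the engine's two regular currencies at ANY place `v ∋ ℓ` (involution on `E[2^M]` / on `E[2]`), via gk2-p2's
  `frob_involutive_and_moves_twoTorsion_of_transposition`;
* §1 `bottomRung_newPrime_inputs_of_K_regular`, `localization_two_nsmul_eq_zero_of_K_regular` — p-g16's §3 with `(hΔ, FrobEqFrobInfty W K q ℓ)` ↦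
  the engine's regular clause at level `q`; proofs verbatim over the regular dictionary;
* §2 `forall_mem_kummerSelmerStructure_exists_eq_zsmul_regular`, `invWeilPairing_localization_ne_zero_of_newPrime_regular` — the same for
  `…RTBottomRungNewPrime` §2–§3 over `natCard_kummerLocalConditionAt_two_pow_eq_regular`.

HONEST FRAMING.  Plumbing over landed theorems (LEAD g16, the sibling route's regular engine, gk2-p2 g22's frame file); closes nothing; BSD is not proved.

References: [McCallumLMS1991] §4 Prop. 4.4, §5 Lemma 5.3 and proof of Prop. 5.2; [GrossLMS1991] §3 (3.1)–(3.3), Prop. 6.2, §9 Prop. 9.6;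
[MilneADT2006] I Cor. 3.4; [WZhang2014] Notations (xii).
-/

set_option autoImplicit false
-- the Theorems namespace of this sub repeats the summit name by design (D-0017 nested layout)
set_option linter.dupNamespace false

noncomputable section

open scoped Classical

open Field NumberField IsDedekindDomain Function WeierstrassCurve
open Literature.NumberTheory.EllipticCurves
open Literature.NumberTheory.GaloisRepresentations
open Literature.NumberTheory.GaloisCohomology
open Summit.BirchSwinnertonDyer.Rank1Residual.X11b.FiniteDuality
open Summit.BirchSwinnertonDyer.Rank1Residual.X11b.Relaxation
open Summit.BirchSwinnertonDyer.BirchSwinnertonDyer.Theorems.GenusExact.SelmerDescent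
open Summit.BirchSwinnertonDyer.BirchSwinnertonDyer.Theorems.OffBigImageOddLocalAtTwo.Engine
  (zsmul_mem_torsionLocalKer_iff_resTorsion_of_notMem_regular natCard_kummerLocalConditionAt_two_pow_eq_regular)
open Summit.BirchSwinnertonDyer.BirchSwinnertonDyer.Theorems.GenusExact.PlusDescent (frob_involutive_and_moves_twoTorsion_of_transposition)

namespace Summit.BirchSwinnertonDyer.BirchSwinnertonDyer.Theorems.GenusExact.RelaxedCount

/-! ## §0 From the transposition clause to the engine's regular currencies -/

section Currency

variable (W : WeierstrassCurve ℚ) [W.IsElliptic] [W.IsGloballyMinimal] {K : Type} [Field K] [NumberField K]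

/-- **Transposition-deep ⟹ regular at level `2^M`, at every place above `ℓ`.**  At a Zhang–Kolyvagin prime `ℓ` at `2` of index `≥ M ≥ 1` carrying
gk2-p2's transposition clause, for every place `v ∋ ℓ` of `ℚ` there is an arithmetic Frobenius `h` at a prime `𝔓 ∣ v` of `\bar ℤ` with `h² = 1` on
`E[2^M]` and `h • u ≠ u` for some `u ∈ E[2]` — the hypothesis `hreg` of the sibling route's regular dictionary
`Engine.zsmul_mem_torsionLocalKer_iff_resTorsion(_of_notMem)_regular`.  (Any Frobenius above a transposition-deep prime qualifies:
gk2-p2 `frob_involutive_and_moves_twoTorsion_of_transposition`.) [cite: GrossLMS1991, §3 (3.1)–(3.3)] [cite: WZhang2014, Notations (xii)] -/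
theorem regularFrob_level_of_transposition {M ℓ : ℕ} (hM : 1 ≤ M)
    (hKol : Zhang2014.IsKolyvaginPrime (W.conductorNorm ℤ) W K 2 ℓ) (hidx : M ≤ Zhang2014.kolyvaginIndex W 2 ℓ)
    (hT : ∃ (v : HeightOneSpectrum (𝓞 ℚ)) (𝔓 : Ideal (absIntegers (𝓞 ℚ) ℚ)) (h : absoluteGaloisGroup ℚ),
      (ℓ : 𝓞 ℚ) ∈ v.asIdeal ∧ 𝔓 ∈ v.primesAbove ∧ IsArithFrobAt (𝓞 ℚ) h 𝔓 ∧ ∃ u : geomTorsion W 2, h • u ≠ u)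
    {v : HeightOneSpectrum (𝓞 ℚ)} (hℓv : (ℓ : 𝓞 ℚ) ∈ v.asIdeal) :
    ∃ (𝔓₀ : Ideal (absIntegers (𝓞 ℚ) ℚ)) (h : absoluteGaloisGroup ℚ), 𝔓₀ ∈ v.primesAbove ∧
      IsArithFrobAt (𝓞 ℚ) h 𝔓₀ ∧ (∀ X : geomTorsion W ((2 ^ M : ℕ) : ℤ), h • h • X = X) ∧ ∃ u : geomTorsion W 2, h • u ≠ u := by
  have h𝔓 := adicCompletionPrime_mem_primesAbove ℚ v
  obtain ⟨h₀, hh₀⟩ := HeightOneSpectrum.exists_isArithFrobAt_of_mem_primesAbove_holds h𝔓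
  obtain ⟨hinv, hmv⟩ := frob_involutive_and_moves_twoTorsion_of_transposition W K hM hKol hidx hT hℓv h𝔓 hh₀
  exact ⟨_, h₀, h𝔓, hh₀, hinv, hmv⟩

/-- **Transposition-deep ⟹ regular on `E[2]`, at every place above `ℓ`** — the hypothesis `hreg` of the sibling route's regular local structure
(`Engine.natCard_ker_zsmul_adicCompletion_two_pow_eq_regular`, `Engine.natCard_kummerLocalConditionAt_two_pow_eq_regular`: involution on `E[2]`,
a moved point of `E[2]`, both typed at `((2 : ℕ) : ℤ)`). [cite: GrossLMS1991, §3 (3.1)–(3.3)] -/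
theorem regularFrob_two_of_transposition {ℓ : ℕ}
    (hKol : Zhang2014.IsKolyvaginPrime (W.conductorNorm ℤ) W K 2 ℓ)
    (hT : ∃ (v : HeightOneSpectrum (𝓞 ℚ)) (𝔓 : Ideal (absIntegers (𝓞 ℚ) ℚ)) (h : absoluteGaloisGroup ℚ),
      (ℓ : 𝓞 ℚ) ∈ v.asIdeal ∧ 𝔓 ∈ v.primesAbove ∧ IsArithFrobAt (𝓞 ℚ) h 𝔓 ∧ ∃ u : geomTorsion W 2, h • u ≠ u)
    {v : HeightOneSpectrum (𝓞 ℚ)} (hℓv : (ℓ : 𝓞 ℚ) ∈ v.asIdeal) :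
    ∃ (𝔓 : Ideal (absIntegers (𝓞 ℚ) ℚ)) (h : absoluteGaloisGroup ℚ), 𝔓 ∈ v.primesAbove ∧
      IsArithFrobAt (𝓞 ℚ) h 𝔓 ∧ (∀ P : geomTorsion W ((2 : ℕ) : ℤ), h • h • P = P) ∧
      ∃ u : geomTorsion W ((2 : ℕ) : ℤ), h • u ≠ u := by
  -- index `≥ 1` is part of being a Zhang–Kolyvagin prime
  have hidx : 1 ≤ Zhang2014.kolyvaginIndex W 2 ℓ := hKol.2.2.2.2.2
  obtain ⟨𝔓₀, h, h𝔓₀, hh, hinv, u, hu⟩ := regularFrob_level_of_transposition W (M := 1) le_rfl hKol hidx hT hℓv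
  have hu2 : (u : geomPoints W) ∈ geomTorsion W ((2 : ℕ) : ℤ) := by
    rw [mem_geomTorsion_iff]
    exact_mod_cast (mem_geomTorsion_iff W 2 _).mp u.2
  refine ⟨𝔓₀, h, h𝔓₀, hh, fun P ↦ ?_, ⟨u.1, hu2⟩, fun e ↦ hu (Subtype.ext (congrArg Subtype.val e))⟩
  have hP : (P : geomPoints W) ∈ geomTorsion W ((2 ^ 1 : ℕ) : ℤ) := by
    rw [pow_one]
    exact P.2
  exact Subtype.ext (congrArg Subtype.val (hinv ⟨P, hP⟩))

end Currency

/-! ## §1 The `ℓ′`-inputs and the free-prime input from the relation over `K`, at a regular prime -/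

section Rat

variable (W : WeierstrassCurve ℚ) [W.IsElliptic] {K : Type} [Field K] [NumberField K]

/-- **The `ℓ′`-inputs of the bottom rung from Q2 and the Čebotarev choice (even depth), at a REGULAR new prime** — LEAD g16's
`bottomRung_newPrime_inputs_of_K` with `(hΔ : W.Δ < 0)` deleted and `FrobEqFrobInfty W K q ℓ` replaced by the sibling engine's regular clause at
level `q` (some Frobenius above `v` is an involution of `E[q]` moving a point of `E[2]`); conclusion verbatim: `hmeet` (every multiple of `loc_{ℓ′} Z`
in `H¹_f` vanishes) and `hz` (`2^(M−1) • loc_{ℓ′} Z ≠ 0`).  Proof verbatim over `Engine.zsmul_mem_torsionLocalKer_iff_resTorsion_of_notMem_regular`.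
[cite: McCallumLMS1991, §4 Prop. 4.4 and §5 proof of Prop. 5.2] [cite: GrossLMS1991, Prop. 6.2] -/
theorem bottomRung_newPrime_inputs_of_K_regular {M : ℕ} (hM : 1 ≤ M) {q : ℕ} (hq : q = 2 ^ M) [NeZero q]
    {ℓ : ℕ} (hℓ : ℓ.Prime) (hℓ2 : ℓ ≠ 2) {v : HeightOneSpectrum (𝓞 ℚ)} (hℓv : (ℓ : 𝓞 ℚ) ∈ v.asIdeal)
    (hgood : W.HasGoodReductionAt v) (h2K : Module.finrank ℚ K = 2) {θ : K} (hθ : θ ∉ (algebraMap ℚ K).range) {c : ℤ}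
    (hc : θ ^ 2 = algebraMap ℚ K c) (hcv : ((c : ℤ) : 𝓞 ℚ) ∉ v.asIdeal)
    (hreg : ∃ (𝔓₀ : Ideal (absIntegers (𝓞 ℚ) ℚ)) (h : absoluteGaloisGroup ℚ), 𝔓₀ ∈ v.primesAbove ∧
      IsArithFrobAt (𝓞 ℚ) h 𝔓₀ ∧ (∀ X : geomTorsion W (q : ℤ), h • h • X = X) ∧ ∃ u : geomTorsion W 2, h • u ≠ u)
    (w : HeightOneSpectrum (𝓞 K)) [w.asIdeal.LiesOver v.asIdeal] (hf : w.asIdeal.inertiaDeg (𝓞 ℚ) = 2)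
    {Z : galoisCohomology (W.torsionGaloisModule (q : ℤ)) 1} {cK cK' : galH1Torsion (W.baseChange K) (q : ℤ)}
    (hZ : resTorsion W K (q : ℤ) Z = cK')
    (hRel : ∀ j : ℕ,
      (((2 ^ j : ℕ) : ℤ) • cK' ∈ selmerLocalKer (W.baseChange K) (w.adicCompletion K) (q : ℤ) ↔
        ((2 ^ j : ℕ) : ℤ) • cK' ∈ (W.baseChange K).torsionLocalKer (w.adicCompletion K) (q : ℤ)) ∧
      (((2 ^ j : ℕ) : ℤ) • cK' ∈ (W.baseChange K).torsionLocalKer (w.adicCompletion K) (q : ℤ) ↔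
        ((2 ^ j : ℕ) : ℤ) • cK ∈ (W.baseChange K).torsionLocalKer (w.adicCompletion K) (q : ℤ)))
    (hOrd : ∀ j : ℕ, ((2 ^ j : ℕ) : ℤ) • cK ∈ (W.baseChange K).torsionLocalKer (w.adicCompletion K) (q : ℤ) ↔ M ≤ j) :
    (∀ k : ℤ, k • galoisCohomology.localization (W.torsionGaloisModule (q : ℤ)) (Sum.inr v) 1 Z ∈
        W.kummerSelmerStructure (q : ℤ) (Sum.inr v : Place ℚ) →
      k • galoisCohomology.localization (W.torsionGaloisModule (q : ℤ)) (Sum.inr v) 1 Z = 0) ∧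
    ((2 ^ (M - 1) : ℕ) : ℤ) • galoisCohomology.localization (W.torsionGaloisModule (q : ℤ)) (Sum.inr v) 1 Z ≠ 0 := by
  -- (adapted from LEAD g16 `bottomRung_newPrime_inputs_of_K`; the Gross-prime dictionary ↦ the regular one)
  obtain ⟨h2v, hqv⟩ := two_notMem_and_natCast_two_pow_notMem hq hℓ hℓ2 hℓv
  have hdT : ∀ c' : ℤ, c' • Z ∈ W.torsionLocalKer (v.adicCompletion ℚ) (q : ℤ) ↔
      c' • cK' ∈ (W.baseChange K).torsionLocalKer (w.adicCompletion K) (q : ℤ) := fun c' ↦ by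
    rw [← hZ]
    exact zsmul_mem_torsionLocalKer_iff_resTorsion_of_notMem_regular W hM hq hℓ hℓ2 hℓv hgood h2K hθ hc hcv hreg w hf Z c'
  have hdS : ∀ c' : ℤ, c' • Z ∈ selmerLocalKer W (v.adicCompletion ℚ) (q : ℤ) ↔
      c' • cK' ∈ selmerLocalKer (W.baseChange K) (w.adicCompletion K) (q : ℤ) := fun c' ↦ by
    rw [← hZ]
    exact zsmul_mem_selmerLocalKer_iff_resTorsion W h2K hθ hc (q : ℤ) v w hgood hqv h2v hcv Z c'
  have hS : ∀ j : ℕ, ((2 ^ j : ℕ) : ℤ) • Z ∈ selmerLocalKer W (v.adicCompletion ℚ) (q : ℤ) → M ≤ j := fun j hj ↦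
    (hOrd j).mp ((hRel j).2.mp ((hRel j).1.mp ((hdS _).mp hj)))
  have hT : ((2 ^ M : ℕ) : ℤ) • Z ∈ W.torsionLocalKer (v.adicCompletion ℚ) (q : ℤ) :=
    (hdT _).mpr ((hRel M).2.mpr ((hOrd M).mpr le_rfl))
  refine ⟨zsmul_localization_eq_zero_of_mem_kummerSelmerStructure W q v Z hS hT, ?_⟩
  refine zsmul_localization_ne_zero_of_notMem_torsionLocalKer W q v Z _ fun hN ↦ ?_
  have hle : M ≤ M - 1 := (hOrd (M - 1)).mp ((hRel (M - 1)).2.mp ((hdT _).mp hN))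
  omega

/-- **`hXs` at a free own prime from Q2 (even depth), at a REGULAR free prime** — LEAD g16's `localization_two_nsmul_eq_zero_of_K` with
`(hΔ, FrobEqFrobInfty)` ↦ the regular clause at level `q`: `res_K Z = c_K′`, `2 • c_K = 0` and Q2's second clause at `w` for `j = 1` give
`loc_ℓ (2 • Z) = 0`. [cite: McCallumLMS1991, §4 Prop. 4.4] -/
theorem localization_two_nsmul_eq_zero_of_K_regular {M : ℕ} (hM : 1 ≤ M) {q : ℕ} (hq : q = 2 ^ M) [NeZero q]
    {ℓ : ℕ} (hℓ : ℓ.Prime) (hℓ2 : ℓ ≠ 2) {v : HeightOneSpectrum (𝓞 ℚ)} (hℓv : (ℓ : 𝓞 ℚ) ∈ v.asIdeal)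
    (hgood : W.HasGoodReductionAt v) (h2K : Module.finrank ℚ K = 2) {θ : K} (hθ : θ ∉ (algebraMap ℚ K).range) {c : ℤ}
    (hc : θ ^ 2 = algebraMap ℚ K c) (hcv : ((c : ℤ) : 𝓞 ℚ) ∉ v.asIdeal)
    (hreg : ∃ (𝔓₀ : Ideal (absIntegers (𝓞 ℚ) ℚ)) (h : absoluteGaloisGroup ℚ), 𝔓₀ ∈ v.primesAbove ∧
      IsArithFrobAt (𝓞 ℚ) h 𝔓₀ ∧ (∀ X : geomTorsion W (q : ℤ), h • h • X = X) ∧ ∃ u : geomTorsion W 2, h • u ≠ u)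
    (w : HeightOneSpectrum (𝓞 K)) [w.asIdeal.LiesOver v.asIdeal] (hf : w.asIdeal.inertiaDeg (𝓞 ℚ) = 2)
    {Z : galoisCohomology (W.torsionGaloisModule (q : ℤ)) 1} {cK cK' : galH1Torsion (W.baseChange K) (q : ℤ)}
    (hZ : resTorsion W K (q : ℤ) Z = cK')
    (hRel₁ : ((2 ^ 1 : ℕ) : ℤ) • cK' ∈ (W.baseChange K).torsionLocalKer (w.adicCompletion K) (q : ℤ) ↔
      ((2 ^ 1 : ℕ) : ℤ) • cK ∈ (W.baseChange K).torsionLocalKer (w.adicCompletion K) (q : ℤ))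
    (hcK : (2 : ℤ) • cK = 0) :
    galoisCohomology.localization (W.torsionGaloisModule (q : ℤ)) (Sum.inr v) 1 ((2 : ℕ) • Z) = 0 := by
  -- (adapted from LEAD g16 `localization_two_nsmul_eq_zero_of_K`)
  have h2 : ((2 ^ 1 : ℕ) : ℤ) = 2 := by norm_num
  rw [h2] at hRel₁
  have hK0 : (2 : ℤ) • cK ∈ (W.baseChange K).torsionLocalKer (w.adicCompletion K) (q : ℤ) := by
    rw [hcK]; exact AddSubgroup.zero_mem _
  have hv2 : (2 : ℤ) • Z ∈ W.torsionLocalKer (v.adicCompletion ℚ) (q : ℤ) := by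
    have h := hRel₁.mpr hK0
    rw [← hZ] at h
    exact (zsmul_mem_torsionLocalKer_iff_resTorsion_of_notMem_regular W hM hq hℓ hℓ2 hℓv hgood h2K hθ hc hcv hreg w hf Z 2).mpr h
  rw [← ofNat_zsmul]
  exact localization_zsmul_eq_zero_of_mem_torsionLocalKer W q v Z 2 hv2

end Rat

/-! ## §2 (hgen) and `hl'` at a regular new prime -/

section NewPrime

variable (W : WeierstrassCurve ℚ) [W.IsElliptic] [W.IsGloballyMinimal]

/-- **(hgen) at a REGULAR Kolyvagin prime of index `≥ M`** — LEAD g16's `forall_mem_kummerSelmerStructure_exists_eq_zsmul` with `(hΔ, FrobEqFrobInfty W K 2 ℓ)`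
↦ the sibling engine's regular clause on `E[2]`: `#𝓛_v = 2^M` (`Engine.natCard_kummerLocalConditionAt_two_pow_eq_regular`) `= addOrderOf (loc_v y)`, so
`y` generates `𝓛_v`. [cite: McCallumLMS1991, §5 Lemma 5.3] [cite: GrossLMS1991, Prop. 6.2] -/
theorem forall_mem_kummerSelmerStructure_exists_eq_zsmul_regular
    {ℓ : ℕ} [Fact ℓ.Prime] (hℓ2 : ℓ ≠ 2) (hgoodℓ : W.HasGoodReductionAtPrime ℓ)
    {v : HeightOneSpectrum (𝓞 ℚ)} (hv : (ℓ : 𝓞 ℚ) ∈ v.asIdeal)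
    (hreg : ∃ (𝔓 : Ideal (absIntegers (𝓞 ℚ) ℚ)) (h : absoluteGaloisGroup ℚ), 𝔓 ∈ v.primesAbove ∧
      IsArithFrobAt (𝓞 ℚ) h 𝔓 ∧ (∀ P : geomTorsion W ((2 : ℕ) : ℤ), h • h • P = P) ∧
      ∃ u : geomTorsion W ((2 : ℕ) : ℤ), h • u ≠ u)
    {M : ℕ} (hM : 1 ≤ M) (hMi : M ≤ Zhang2014.kolyvaginIndex W 2 ℓ)
    {q : ℕ} (hq : q = 2 ^ M) [NeZero q] (y : galoisCohomology (W.torsionGaloisModule (q : ℤ)) 1)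
    (hyK : y ∈ selmerLocalKer W (v.adicCompletion ℚ) (q : ℤ))
    (hOrd : ∀ j : ℕ, ((2 ^ j : ℕ) : ℤ) • y ∈ W.torsionLocalKer (v.adicCompletion ℚ) (q : ℤ) ↔ M ≤ j) :
    ∀ f ∈ W.kummerSelmerStructure (q : ℤ) (Sum.inr v : Place ℚ),
      ∃ k : ℤ, f = k • galoisCohomology.localization (W.torsionGaloisModule (q : ℤ)) (Sum.inr v) 1 y := by
  -- (adapted from LEAD g16 `forall_mem_kummerSelmerStructure_exists_eq_zsmul`)
  have hcard : Nat.card (W.kummerSelmerStructure (q : ℤ) (Sum.inr v : Place ℚ)) = 2 ^ M := by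
    subst hq
    exact natCard_kummerLocalConditionAt_two_pow_eq_regular W hℓ2 hgoodℓ hv hreg hMi
  haveI : Finite (W.kummerSelmerStructure (q : ℤ) (Sum.inr v : Place ℚ)) :=
    Nat.finite_of_card_ne_zero (by rw [hcard]; exact pow_ne_zero M two_ne_zero)
  refine forall_mem_exists_eq_zsmul_of_addOrderOf_eq_natCard (W.kummerSelmerStructure (q : ℤ) (Sum.inr v : Place ℚ))
    ((res_mem_kummerLocalConditionAt_iff W (q : ℤ) (Place.Completion (Sum.inr v : Place ℚ)) y).mpr hyK) ?_
  rw [hcard]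
  exact addOrderOf_localization_eq_two_pow W q hM v y hOrd

variable (n : ℕ) [NeZero n]
variable (e : W.geomTorsion n → W.geomTorsion n → AlgebraicClosure ℚ)
  (hμ : ∀ S T, e S T ^ n = 1)
  (hadd₁ : ∀ S₁ S₂ T, e (S₁ + S₂) T = e S₁ T * e S₂ T)
  (hadd₂ : ∀ S T₁ T₂, e S (T₁ + T₂) = e S T₁ * e S T₂)
  (hgal : ∀ (σ : absoluteGaloisGroup ℚ) (S T : W.geomTorsion n), σ • e S T = e (σ • S) (σ • T))

/-- **`hl'` of `false_of_bottomRung` at a REGULAR new prime** — LEAD g16's `invWeilPairing_localization_ne_zero_of_newPrime` with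
`(hΔ, FrobEqFrobInfty W K 2 ℓ)` ↦ the regular clause on `E[2]`: **`inv_{ℓ′}(loc (2•Z) ∪ₑ loc y) ≠ 0`** from (hF), (hgen) regular, (hmeet), (hz).
[cite: McCallumLMS1991, §5 Lemma 5.3 and proof of Prop. 5.2] -/
theorem invWeilPairing_localization_ne_zero_of_newPrime_regular
    {ℓ : ℕ} [Fact ℓ.Prime] (hℓ2 : ℓ ≠ 2) (hgoodℓ : W.HasGoodReductionAtPrime ℓ)
    {v : HeightOneSpectrum (𝓞 ℚ)} (hv : (ℓ : 𝓞 ℚ) ∈ v.asIdeal)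
    (hreg : ∃ (𝔓 : Ideal (absIntegers (𝓞 ℚ) ℚ)) (h : absoluteGaloisGroup ℚ), 𝔓 ∈ v.primesAbove ∧
      IsArithFrobAt (𝓞 ℚ) h 𝔓 ∧ (∀ P : geomTorsion W ((2 : ℕ) : ℤ), h • h • P = P) ∧
      ∃ u : geomTorsion W ((2 : ℕ) : ℤ), h • u ≠ u)
    {M : ℕ} (hM : 1 ≤ M) (hMi : M ≤ Zhang2014.kolyvaginIndex W 2 ℓ)
    (hn : n = 2 ^ M) (inv : LocalInvariants ℚ n)
    (hF : annLeft (invWeilPairing W n e hμ hadd₁ hadd₂ hgal inv (Sum.inr v)) (W.kummerSelmerStructure (n : ℤ) (Sum.inr v : Place ℚ)) ≤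
      W.kummerSelmerStructure (n : ℤ) (Sum.inr v : Place ℚ))
    {Z y : galoisCohomology (W.torsionGaloisModule (n : ℤ)) 1}
    (hyK : y ∈ selmerLocalKer W (v.adicCompletion ℚ) (n : ℤ))
    (hOrd : ∀ j : ℕ, ((2 ^ j : ℕ) : ℤ) • y ∈ W.torsionLocalKer (v.adicCompletion ℚ) (n : ℤ) ↔ M ≤ j)
    (hmeet : ∀ k : ℤ, k • galoisCohomology.localization (W.torsionGaloisModule (n : ℤ)) (Sum.inr v) 1 Z ∈
        W.kummerSelmerStructure (n : ℤ) (Sum.inr v : Place ℚ) →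
      k • galoisCohomology.localization (W.torsionGaloisModule (n : ℤ)) (Sum.inr v) 1 Z = 0)
    (hz : (2 : ℤ) • galoisCohomology.localization (W.torsionGaloisModule (n : ℤ)) (Sum.inr v) 1 Z ≠ 0) :
    invWeilPairing W n e hμ hadd₁ hadd₂ hgal inv (Sum.inr v)
      (galoisCohomology.localization (W.torsionGaloisModule (n : ℤ)) (Sum.inr v) 1 ((2 : ℕ) • Z))
      (galoisCohomology.localization (W.torsionGaloisModule (n : ℤ)) (Sum.inr v) 1 y) ≠ 0 := by
  rw [map_nsmul]
  exact pairing_two_nsmul_ne_zero_of_lagrangian _ _ hF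
    (forall_mem_kummerSelmerStructure_exists_eq_zsmul_regular W hℓ2 hgoodℓ hv hreg hM hMi hn y hyK hOrd) hmeet hz

end NewPrime

end Summit.BirchSwinnertonDyer.BirchSwinnertonDyer.Theorems.GenusExact.RelaxedCount

end
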